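import Literature.AnabelianGeometry.EtaleTheta.Discharge.Sec3Thm37Standard
import Literature.AlgebraicGeometry.Frobenioids.ModelFrobenioidAutAction
import HarnessLib

/-!
# [EtTh] Theorem 3.7 (iii), the Frobenioid-side half — "the natural action of `Aut_C(A)` on `O^▷(A)`,
# `O^×(A)` factors through [the base]" — PROVED in the tree's vocabulary

Proof-only sequel (theorems only, no definitions) of the `Discharge/Sec3Thm37*.lean` files.
S. Mochizuki, *The étale theta function …*, Publ. RIMS **45** (2009) [EtTh], §3, Theorem 3.7 (iii),
pp. 79–80 = PDF pp. 305–306 of `paper:doi-10-2977-prims-1234361159` [cite: MochizukiEtTh2009, Thm 3.7 (iii) p.79]: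

> "(iii) Let `A ∈ Ob(C)`; `A_D := Base(A) ∈ Ob(D)`. Write `A^cnst ∈ Ob(D^cnst)` for the image of `A_D`
> in `D^cnst`. Then the natural action of `Aut_C(A)` on `O^▷(A)` and `O^×(A)` factors through
> `Aut_{D^cnst}(A^cnst)`. If, moreover, `Λ ∈ {ℤ, ℚ}`, then this factorization determines a faithful
> action of the image of `Aut_C(A)` in `Aut_{D^cnst}(A^cnst)` on `O^▷(A)`, `O^×(A)`."

L2-t3's named `Prop` `TemperedFrobenioid.Thm37_iii F` renders both clauses by FREE facade fields
(`AutActionFactorsThroughCnst`, `AutActionFaithfulCnst`; the data `D^cnst = B(Spec K)⁰`, `A^cnst`,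
`D₀ → D^cnst` are not in the L2 interface — SUBDAG-EtTh-Thm37 rows (iii)/L10–L11, residual R3) and is
not provable for an arbitrary facade.  What IS kernel-checkable is the FROBENIOID-SIDE half (sub-DAG
rows (iii)/L08 `AutViaBaseAndUnit`, (iii)/L09 `ActionThroughBase`): the tempered Frobenioid is the model
Frobenioid of [FrdI] Thm 5.2 (i), whose morphisms are quadruples `(deg_Fr, Base, Div, u)`, and there the
conjugation action of `Aut_C(A)` on `O^▷(A)`, `O^×(A)` is the PULL-BACK action of `Base(α) ∈ Aut_D(A_D)`
(`Frobenioids.ModelFrobenioid.autAction_factorsThroughBase`, `ModelFrobenioidAutAction.lean`): the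
action factors through `Aut_C(A) → Aut_D(A_D)` — the first link of the printed factorisation
`Aut_C(A) → Aut_D(A_D) → Aut_{D₀}(Y_A) → Aut_{D^cnst}(A^cnst)`; the remaining links are the base-side
content of Prop 3.4 (ii) (rows L10/L11, blocked on the definition of `D^cnst`).

* `autAction_factorsThroughBase` — automorphisms of `A ∈ Ob(C)` with the same image in `Aut_D(A_D)` act
  identically on `O^▷(A)` (`PreFrobenioid.endSubmonoid C₀.toElem A`) and on `O^×(A)`
  (`PreFrobenioid.unitsSubgroup C₀.toElem A`) — row (iii)/L09;
* `unit_conj` — the formula `u_{α⁻¹ ∘ σ ∘ α} = Base(α⁻¹)^*(u_σ)` for `σ ∈ O^▷(A)` — row (iii)/L09;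
* `aut_eq_of_baseMap_eq_of_unit_eq` / `_treeCatVocab` — an automorphism of `A` is determined by
  `(Base(α), u_α)` (`Φ` divisorial: standing hypothesis of [FrdI] Thm 5.2, resp. the field
  `isDivisorialOn` at `treeCatVocab`) — row (iii)/L08.
HONEST FRAMING: refereed pre-IUT material; nothing here bears on [IUTchIII] Cor. 3.12; no statement of
either paper is strengthened (the `D^cnst` clauses stay OPEN AS TYPED); here PROVED.
-/

namespace Literature.AnabelianGeometry.EtaleTheta

open CategoryTheory Opposite Literature.AlgebraicGeometry.Frobenioids

universe u₀ v₀ u v w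

variable {D₀ : Type u₀} [Category.{v₀} D₀] {V : FrdIMonoidStub.{w}}
  {T : RealifiedDivisorMonoids (D₀ := D₀) V} {D : Type u} [Category.{v} D]

namespace TemperedFrobenioid

section General

variable {VD : FrdICatStub.{u, v, w} D} (C₀ : TemperedFrobenioid T D VD)

/-- **Thm 3.7 (iii), Frobenioid-side half (sub-DAG row (iii)/L09)**: for an object `A` of the tempered
Frobenioid and automorphisms `α, α'` of `A` with the same image `Base(α) = Base(α')` in `Aut_D(A_D)`,
conjugation by `α` and by `α'` agree on `O^▷(A)` and on `O^×(A)` — the action of `Aut_C(A)` factors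
through `Aut_C(A) → Aut_D(A_D)`. [cite: MochizukiEtTh2009, Thm 3.7 (iii) p.79] -/
theorem autAction_factorsThroughBase (A : C₀.category) (α α' : A ≅ A)
    (h : ModelFrobenioid.baseMap α.hom = ModelFrobenioid.baseMap α'.hom) :
    (∀ f ∈ PreFrobenioid.endSubmonoid C₀.toElem A, α.inv ≫ f ≫ α.hom = α'.inv ≫ f ≫ α'.hom) ∧
      ∀ u ∈ PreFrobenioid.unitsSubgroup C₀.toElem A, α.symm ≪≫ u ≪≫ α = α'.symm ≪≫ u ≪≫ α' :=
  ModelFrobenioid.autAction_factorsThroughBase A α α' h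

/-- **Thm 3.7 (iii), the formula behind it**: for `σ ∈ O^▷(A)` (base-identity, linear) and `α ∈ Aut_C(A)`,
`u_{α⁻¹ ∘ σ ∘ α} = Base(α⁻¹)^*(u_σ)` in `B(A_D)` — the twist `u_α` cancels because `B(A_D)` is
commutative. [cite: MochizukiEtTh2009, Thm 3.7 (iii) p.79] -/
theorem unit_conj {A : C₀.category} (α : A ≅ A) {σ : A ⟶ A}
    (hσ : σ ∈ PreFrobenioid.endSubmonoid C₀.toElem A) :
    ModelFrobenioid.unit (α.inv ≫ σ ≫ α.hom) =
      pull C₀.ratFnFunctor (ModelFrobenioid.baseMap α.inv) (ModelFrobenioid.unit σ) :=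
  ModelFrobenioid.unit_conj' α hσ.1 hσ.2

/-- **Sub-DAG row (iii)/L08 `AutViaBaseAndUnit`**, modulo the standing hypotheses of [FrdI] Thm 5.2
(only "`Φ` divisorial" is used): an automorphism `α` of an object of the tempered Frobenioid is
determined by `(Base(α), u_α)` (`deg_Fr(α) = 1`, `Div(α) = 0` since `Φ(A_D)` is sharp).
[cite: MochizukiEtTh2009, Thm 3.7 (iii) p.79] -/
theorem aut_eq_of_baseMap_eq_of_unit_eq
    (hyp : ModelFrobenioid.Hypotheses C₀.divisorMonoid C₀.ratFnFunctor) {A : C₀.category}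
    {α α' : A ≅ A} (hb : ModelFrobenioid.baseMap α.hom = ModelFrobenioid.baseMap α'.hom)
    (hu : ModelFrobenioid.unit α.hom = ModelFrobenioid.unit α'.hom) : α = α' :=
  ModelFrobenioid.aut_eq_of_baseMap_eq_of_unit_eq hyp.isDivisorial hb hu

end General

/-! ## At the canonical [FrdI] vocabulary `treeCatVocab` -/

section TreeVocab

variable {IsRational IsStrictlyRational : (Dᵒᵖ ⥤ CommMonCat.{w}) → Prop}
  (C₀ : TemperedFrobenioid T D (treeCatVocab D IsRational IsStrictlyRational))

/-- **Sub-DAG row (iii)/L08 at the canonical vocabulary — UNCONDITIONAL**: an automorphism of an object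
of the tempered Frobenioid is determined by `(Base(α), u_α)` (`Φ` divisorial = field `isDivisorialOn`).
[cite: MochizukiEtTh2009, Thm 3.7 (iii) p.79] -/
theorem aut_eq_of_baseMap_eq_of_unit_eq_treeCatVocab {A : C₀.category} {α α' : A ≅ A}
    (hb : ModelFrobenioid.baseMap α.hom = ModelFrobenioid.baseMap α'.hom)
    (hu : ModelFrobenioid.unit α.hom = ModelFrobenioid.unit α'.hom) : α = α' :=
  ModelFrobenioid.aut_eq_of_baseMap_eq_of_unit_eq C₀.isDivisorial_divisorMonoid hb hu

/-- `α ↦ (Base(α), u_α)` is injective on `Aut_C(A)` (canonical vocabulary, unconditional).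
[cite: MochizukiEtTh2009, Thm 3.7 (iii) p.79] -/
theorem injective_baseMap_unit_treeCatVocab (A : C₀.category) :
    Function.Injective fun α : A ≅ A => (ModelFrobenioid.baseMap α.hom, ModelFrobenioid.unit α.hom) :=
  ModelFrobenioid.injective_baseMap_unit C₀.isDivisorial_divisorMonoid

end TreeVocab

end TemperedFrobenioid

end Literature.AnabelianGeometry.EtaleTheta
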